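import Summits.CriticalPhenomena.PercolationContinuityZ3.Theorems.PercNearOneGluingNoHeavyQuantConvDominant
import HarnessLib

/-!
# QUANT lane R8, T-DEC: THE PER-COMPONENT BUDGET for the convolution at far-dominant layers `4j < 2T₂ + T₁` (part 1 of 2 of
# `…QuantConvFarDominant`): `W − y ≥ (1−y)·up − y·dl` for EVERY valid component of the second factor — light credit pairs included

builds on p205010 (kernel theorem, internal audit signed; external expert review pending)

Support file (`--supports stmt-CriticalPhenomena-4575`), QUANT lane seat prim-quant-arm-2 (gen 34), rung R8 of
`run/shared/lean/prim/quant/LADDER.md`.  Theorems only (no definitions), standard axioms, no sorries.  Continues this seat's `…QuantDeepLowsGiants`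
and `…QuantConvDominant`.

WHAT.  `μ₁` a top-affordable probability law on `{0..M₁}` DEC at every layer (mean `T₁`), `{lo ≤ hi; g}` a component VALID at `(y, T₂, j)`
(`LawDec.ValidAt`: point, giant pair, or credit pair — heavy OR LIGHT), `Ψ(s) = μ₁{i : i + s ≥ j+1}` the bare tail, `W = g·Ψ(hi) + (1−g)·Ψ(lo)` the
tail of `μ₁ ∗ {lo,hi;g}` above `j`.  If `4j < 2T₂ + T₁` then **`W − y ≥ (1−y)·up − y·dl`** (`piece_budget`), `up = g[hi > j] + (1−g)[lo > j]` the
component's mass above `j`, `dl = (1−g)[lo ≤ j ∧ lo + j < T₂] + g[hi ≤ j ∧ hi + j < T₂]` its mass at the DEEP atoms of layer `j` (those with no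
compatible mid: `h + m ≤ h + j < T₂`).  Cases: a point or pair above `j` is worth `1`; a self-sufficient point `b ≤ j` reads `μ₁`'s dominant row at
`j − b`; a giant pair `{lo ≤ j < hi; g ≥ y}` is worth `≥ g + (1−g)Ψ(lo)`, and `Ψ(lo) ≥ y` when `lo` is NOT deep (then `2(j − lo) ≤ 2(2j − T₂) < T₁`:
this is where the regime enters); a credit pair `{lo < hi ≤ j}` is worth `(1−g)τ + g(1−u)` with `y·u ≤ (1−y)τ` (`deepLows_le_giants` at
`(j−lo, j−hi)`, valid because the credit rate is `≤ 1`, so `lo + hi ≥ T₂`): `≥ y` if heavy or if `lo` is not deep, `≥ −y(1−g) + y` if light and deep.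
Also `deepLows_le_giants_pred`: the two-layer giant bound with the deep set written as a predicate, `y·μ{h ≤ i : h + i < T} ≤ (1−y)·μ{h > i}`.
Part 2 sums the budget over a datum of `μ₂` against `deepLows_le_giants_pred` for `μ₂`.
HONEST STATUS: tools; `ConvClosedT`, `SDECConvClosed`, `SingleGateConvClosed`, `TreeDEC`, `FarTreeRow` OPEN; RATE class log\* / honest sentence unchanged.

[this work]; DEC rules ARCH-TREES-G49 §2.2 / DEC-TAMP-G50 §3.1, §3.3 (this lane).  Nothing here is cited as a published result.  The gluing rows
served [cite: KozmaNitzan2024, Conjecture 3 (p. 15)]; product measure [cite: Grimmett1999, §1.3 p. 10].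
-/

noncomputable section

namespace Summit.CriticalPhenomena.PercolationContinuityZ3.Theorems

namespace Quant

open Finset

/-- the two-point law `{lo, hi; g}` (as in `…QuantLawDEC`) -/
local notation3 "TP[" lo ", " hi ", " g ", " h "]" =>
  (g : ℝ) * (if (h : ℕ) = (hi : ℕ) then (1 : ℝ) else 0) + (1 - (g : ℝ)) * (if (h : ℕ) = (lo : ℕ) then (1 : ℝ) else 0)

namespace LawDec

/-! ### The deep set as a predicate -/

/-- **two-layer giant bound, predicate form**: `μ` a top-affordable probability law DEC at every layer below its top, a layer `i`; then
`y·μ{h ≤ i : h + i < T} ≤ (1−y)·μ{h > i}` (`deepLows_le_giants` at the largest deep atom, or trivial if there is none). [this work] -/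
theorem deepLows_le_giants_pred (y T : ℝ) (M i : ℕ) (μ : ℕ → ℝ) (hy0 : 0 < y) (hy1 : y < 1)
    (hμ0 : ∀ h, 0 ≤ μ h) (hμM : ∀ h, M < h → μ h = 0) (hμ1 : ∑ h ∈ Finset.range (M + 1), μ h = 1)
    (hT : ∑ h ∈ Finset.range (M + 1), (h : ℝ) * μ h = T) (hta : y * (M : ℝ) ≤ T)
    (hdec : ∀ j', j' < M → DECAt y j' M μ) :
    y * ∑ h ∈ Finset.range (M + 1), (if h ≤ i ∧ (h : ℝ) + i < T then μ h else 0)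
      ≤ (1 - y) * ∑ h ∈ Finset.range (M + 1), (if i + 1 ≤ h then μ h else 0) := by
  classical
  by_cases h0 : (0 : ℝ) + i < T
  · -- the largest deep atom `i′ ≤ i`
    let i' : ℕ := Nat.findGreatest (fun l => (l : ℝ) + i < T) i
    have hi'P : ((i' : ℕ) : ℝ) + i < T := by
      have := Nat.findGreatest_spec (P := fun l => (l : ℝ) + i < T) (Nat.zero_le i) (by simpa using h0)
      exact this
    have hi'i : i' ≤ i := Nat.findGreatest_le i
    have hset : ∀ h, (h ≤ i ∧ (h : ℝ) + i < T) ↔ h ≤ i' := by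
      intro h
      constructor
      · rintro ⟨hhi, hP⟩
        exact Nat.le_findGreatest hhi hP
      · intro hh
        refine ⟨hh.trans hi'i, ?_⟩
        have : (h : ℝ) ≤ i' := by exact_mod_cast hh
        linarith
    have e : ∑ h ∈ Finset.range (M + 1), (if h ≤ i ∧ (h : ℝ) + i < T then μ h else 0)
        = ∑ h ∈ Finset.range (M + 1), (if h ≤ i' then μ h else 0) := by
      refine Finset.sum_congr rfl fun h _ => ?_
      by_cases hc : h ≤ i ∧ (h : ℝ) + i < T
      · rw [if_pos hc, if_pos ((hset h).1 hc)]
      · rw [if_neg hc, if_neg (fun hh => hc ((hset h).2 hh))]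
    rw [e]
    have hdeep : (i : ℝ) + i' < T := by linarith
    exact deepLows_le_giants y T M i i' μ hy0 hy1 hμ0 hμM hμ1 hT hta hdec hi'i hdeep
  · -- no deep atom
    have e : ∑ h ∈ Finset.range (M + 1), (if h ≤ i ∧ (h : ℝ) + i < T then μ h else 0) = 0 := by
      refine Finset.sum_eq_zero fun h _ => ?_
      rw [if_neg]
      rintro ⟨_, hP⟩
      exact h0 (by have : (0 : ℝ) ≤ h := Nat.cast_nonneg h; linarith)
    rw [e, mul_zero]
    exact mul_nonneg (by linarith) (Finset.sum_nonneg fun h _ => by split_ifs; exacts [hμ0 h, le_rfl])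

/-! ### The per-component budget -/

/-- **THE PER-COMPONENT BUDGET in the regime `4j < 2T₂ + T₁`.**  `μ₁` a top-affordable probability law on `{0..M₁}` DEC at every layer (mean
`T₁`); a component `{lo ≤ hi; g}` (`0 ≤ g ≤ 1`) valid at `(y, T₂, j)` (`ValidAt`, light credit pairs allowed); `Ψ(s) = μ₁{i : i + s ≥ j+1}`.  Then
`g·Ψ(hi) + (1−g)·Ψ(lo) − y ≥ (1−y)·up − y·dl` with `up = g[hi > j] + (1−g)[lo > j]` and `dl = (1−g)[lo ≤ j ∧ lo + j < T₂] + g[hi ≤ j ∧ hi + j < T₂]`.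
[this work] -/
theorem piece_budget (y T₁ T₂ : ℝ) (j M₁ lo hi : ℕ) (g : ℝ) (μ₁ : ℕ → ℝ) (hy0 : 0 < y) (hy1 : y < 1)
    (h10 : ∀ h, 0 ≤ μ₁ h) (h1M : ∀ h, M₁ < h → μ₁ h = 0) (h11 : ∑ h ∈ Finset.range (M₁ + 1), μ₁ h = 1)
    (hT₁ : ∑ h ∈ Finset.range (M₁ + 1), (h : ℝ) * μ₁ h = T₁) (hta : y * (M₁ : ℝ) ≤ T₁)
    (hdec : ∀ j', j' < M₁ → DECAt y j' M₁ μ₁) (hg : 0 ≤ g ∧ g ≤ 1) (hlohi : lo ≤ hi)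
    (hval : ValidAt y T₂ j lo hi g) (hdom : 4 * (j : ℝ) < 2 * T₂ + T₁) :
    (1 - y) * (g * (if j + 1 ≤ hi then (1 : ℝ) else 0) + (1 - g) * (if j + 1 ≤ lo then (1 : ℝ) else 0))
      - y * ((1 - g) * (if lo ≤ j ∧ (lo : ℝ) + j < T₂ then (1 : ℝ) else 0) + g * (if hi ≤ j ∧ (hi : ℝ) + j < T₂ then (1 : ℝ) else 0))
      ≤ g * (∑ i ∈ Finset.range (M₁ + 1), μ₁ i * (if j + 1 ≤ i + hi then (1 : ℝ) else 0))
        + (1 - g) * (∑ i ∈ Finset.range (M₁ + 1), μ₁ i * (if j + 1 ≤ i + lo then (1 : ℝ) else 0)) - y := by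
  classical
  -- bare tails `Ψ`
  set Ψ : ℕ → ℝ := fun s => ∑ i ∈ Finset.range (M₁ + 1), μ₁ i * (if j + 1 ≤ i + s then (1 : ℝ) else 0) with hΨ
  show (1 - y) * (g * (if j + 1 ≤ hi then (1 : ℝ) else 0) + (1 - g) * (if j + 1 ≤ lo then (1 : ℝ) else 0))
      - y * ((1 - g) * (if lo ≤ j ∧ (lo : ℝ) + j < T₂ then (1 : ℝ) else 0) + g * (if hi ≤ j ∧ (hi : ℝ) + j < T₂ then (1 : ℝ) else 0))
      ≤ g * Ψ hi + (1 - g) * Ψ lo - y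
  have hΨ0 : ∀ s, 0 ≤ Ψ s := fun s => Finset.sum_nonneg fun i _ => mul_nonneg (h10 i) (by split_ifs <;> norm_num)
  have hΨle1 : ∀ s, Ψ s ≤ 1 := by
    intro s
    calc Ψ s ≤ ∑ i ∈ Finset.range (M₁ + 1), μ₁ i :=
          Finset.sum_le_sum fun i _ => by
            have := h10 i
            split_ifs
            · rw [mul_one]
            · rw [mul_zero]; exact this
      _ = 1 := h11
  have hΨ1 : ∀ s, j + 1 ≤ s → Ψ s = 1 := by
    intro s hs
    have e : ∀ i ∈ Finset.range (M₁ + 1), μ₁ i * (if j + 1 ≤ i + s then (1 : ℝ) else 0) = μ₁ i :=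
      fun i _ => by rw [if_pos (by omega), mul_one]
    show ∑ i ∈ Finset.range (M₁ + 1), μ₁ i * (if j + 1 ≤ i + s then (1 : ℝ) else 0) = 1
    rw [Finset.sum_congr rfl e, h11]
  have hΨtail : ∀ s, s ≤ j → Ψ s = ∑ i ∈ Finset.range (M₁ + 1), (if (j - s) + 1 ≤ i then μ₁ i else 0) := by
    intro s hs
    refine Finset.sum_congr rfl fun i _ => ?_
    by_cases h1 : j + 1 ≤ i + s
    · rw [if_pos h1, if_pos (by omega), mul_one]
    · rw [if_neg h1, if_neg (by omega), mul_zero]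
  -- the row of `μ₁` at a dominant layer `j − s`
  have hrow : ∀ s, s ≤ j → 2 * ((j : ℝ) - s) < T₁ → y ≤ Ψ s := by
    intro s hs hd
    rw [hΨtail s hs]
    refine tail_ge_of_decAt_all y T₁ M₁ (j - s) μ₁ hy0 hy1 h10 h1M h11 hT₁ hta hdec ?_
    rw [Nat.cast_sub hs]; exact hd
  -- a non-deep atom `s ≤ j` (`s + j ≥ T₂`) has a dominant layer `j − s` for `μ₁` in this regime
  have hnondeep : ∀ s, s ≤ j → ¬ ((s : ℝ) + j < T₂) → y ≤ Ψ s := by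
    intro s hs hnd
    exact hrow s hs (by linarith [not_lt.1 hnd])
  have hT1pos : 0 ≤ T₁ := by
    rw [← hT₁]; exact Finset.sum_nonneg fun h _ => mul_nonneg (Nat.cast_nonneg h) (h10 h)
  have hdom2 : 2 * (j : ℝ) < T₁ + T₂ := by linarith
  rcases hval with ⟨heq, hS⟩ | ⟨hlt, hgi, hyg⟩ | ⟨hlt, hhij, hcr⟩
  · -- (S) a point `b = lo = hi`
    subst heq
    by_cases hbj : j + 1 ≤ lo
    · rw [if_pos hbj, hΨ1 _ hbj, if_neg (show ¬ (lo ≤ j ∧ (lo : ℝ) + j < T₂) by intro h; omega)]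
      nlinarith [hg.1, hg.2]
    · have hbj' : lo ≤ j := by omega
      have h2b : T₂ ≤ 2 * (lo : ℝ) := by
        rcases hS with h | h
        · exact h
        · exact absurd h hbj
      rw [if_neg hbj]
      have hr := hrow lo hbj' (by linarith)
      have hd0 : 0 ≤ (1 - g) * (if lo ≤ j ∧ (lo : ℝ) + j < T₂ then (1 : ℝ) else 0)
          + g * (if lo ≤ j ∧ (lo : ℝ) + j < T₂ then (1 : ℝ) else 0) := by
        have : (0 : ℝ) ≤ (if lo ≤ j ∧ (lo : ℝ) + j < T₂ then (1 : ℝ) else 0) := by split_ifs <;> norm_num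
        nlinarith [hg.1, hg.2]
      nlinarith [hg.1, hg.2, hy0]
  · -- (G) a giant pair `hi ≥ j+1`, `g ≥ y`
    rw [if_pos hgi, hΨ1 _ hgi, if_neg (show ¬ (hi ≤ j ∧ (hi : ℝ) + j < T₂) by intro h; omega)]
    by_cases hloj : j + 1 ≤ lo
    · rw [if_pos hloj, hΨ1 _ hloj, if_neg (by intro h; omega)]
      nlinarith [hg.1, hg.2]
    · have hloj' : lo ≤ j := by omega
      rw [if_neg hloj]
      by_cases hd : (lo : ℝ) + j < T₂
      · rw [if_pos ⟨hloj', hd⟩]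
        nlinarith [hΨ0 lo, hg.1, hg.2]
      · rw [if_neg (by rintro ⟨_, h⟩; exact hd h)]
        have hr := hnondeep lo hloj' hd
        nlinarith [hg.1, hg.2]
  · -- (N) a credit pair `lo < hi ≤ j` (heavy or light)
    have hloj : lo ≤ j := hlt.le.trans hhij
    rw [if_neg (by omega : ¬ j + 1 ≤ hi), if_neg (by omega : ¬ j + 1 ≤ lo)]
    -- the credit rate is at most one, so `T₂ ≤ lo + hi`
    have hκ : (if y ≤ g then g else (g - y ^ 2) / (1 - y)) ≤ 1 := by
      split_ifs with hyg
      · exact hg.2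
      · rw [div_le_one (by linarith)]; nlinarith [not_le.1 hyg, hg.1]
    have hd : (0 : ℝ) ≤ (hi : ℝ) - lo := by
      have : (lo : ℝ) ≤ hi := by exact_mod_cast hlt.le
      linarith
    have hcr' : T₂ ≤ (lo : ℝ) + hi := by
      have := mul_le_mul_of_nonneg_left hκ hd
      linarith
    -- two-layer giant bound for `μ₁` at `(j − lo, j − hi)`
    set τ : ℝ := ∑ i ∈ Finset.range (M₁ + 1), (if (j - lo) + 1 ≤ i then μ₁ i else 0) with hτ
    set u : ℝ := ∑ i ∈ Finset.range (M₁ + 1), (if i ≤ j - hi then μ₁ i else 0) with hu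
    have eΨlo : Ψ lo = τ := hΨtail _ hloj
    have eΨhi : Ψ hi = 1 - u := by
      rw [hΨtail _ hhij]
      have hs := sum_le_add_sum_gt M₁ (j - hi) μ₁
      rw [h11] at hs
      linarith
    have hii : j - hi ≤ j - lo := by omega
    have hdeep : ((j - lo : ℕ) : ℝ) + ((j - hi : ℕ) : ℝ) < T₁ := by
      rw [Nat.cast_sub hloj, Nat.cast_sub hhij]; linarith
    have hgb := deepLows_le_giants y T₁ M₁ (j - lo) (j - hi) μ₁ hy0 hy1 h10 h1M h11 hT₁ hta hdec hii hdeep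
    rw [← hτ, ← hu] at hgb
    have hτu : τ ≤ 1 - u := by
      have hmono := sum_gt_antitone M₁ (j - lo) (j - hi) μ₁ h10 hii
      have hs := sum_le_add_sum_gt M₁ (j - hi) μ₁
      rw [h11] at hs
      rw [hτ, hu]; linarith
    have hu0 : 0 ≤ u := Finset.sum_nonneg fun i _ => by split_ifs; exacts [h10 i, le_rfl]
    have hτ0 : 0 ≤ τ := Finset.sum_nonneg fun i _ => by split_ifs; exacts [h10 i, le_rfl]
    rw [eΨlo, eΨhi]
    -- `W = (1−g)τ + g(1−u) ≥ g + τ(y−g)/y`-type bounds; the deep indicators are in `[0,1]`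
    have hI1 : (0 : ℝ) ≤ (if lo ≤ j ∧ (lo : ℝ) + j < T₂ then (1 : ℝ) else 0) := by split_ifs <;> norm_num
    have hI2 : (0 : ℝ) ≤ (if hi ≤ j ∧ (hi : ℝ) + j < T₂ then (1 : ℝ) else 0) := by split_ifs <;> norm_num
    have hR : 0 ≤ y * ((1 - g) * (if lo ≤ j ∧ (lo : ℝ) + j < T₂ then (1 : ℝ) else 0)
        + g * (if hi ≤ j ∧ (hi : ℝ) + j < T₂ then (1 : ℝ) else 0)) :=
      mul_nonneg hy0.le (add_nonneg (mul_nonneg (by linarith [hg.2]) hI1) (mul_nonneg hg.1 hI2))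
    have hu1 : u ≤ 1 - y := by
      have := mul_le_mul_of_nonneg_left hτu (show (0 : ℝ) ≤ 1 - y by linarith)
      linarith
    have h2 : g * u ≤ g * (1 - y) := mul_le_mul_of_nonneg_left hu1 hg.1
    have h3 : 0 ≤ y * (g * (if hi ≤ j ∧ (hi : ℝ) + j < T₂ then (1 : ℝ) else 0)) :=
      mul_nonneg hy0.le (mul_nonneg hg.1 hI2)
    have h5 : 0 ≤ (1 - g) * τ := mul_nonneg (by linarith [hg.2]) hτ0
    by_cases hyg : y ≤ g
    · -- heavy: `W ≥ y`
      have h1 : y * (1 - u - τ) ≤ g * (1 - u - τ) := mul_le_mul_of_nonneg_right hyg (by linarith)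
      linarith
    · -- light
      by_cases hdl : (lo : ℝ) + j < T₂
      · -- `lo` deep: `W − y ≥ g(1−u) − y ≥ −y(1−g)`
        rw [if_pos ⟨hloj, hdl⟩]
        linarith
      · -- `lo` not deep: `τ ≥ y`, so `W ≥ y`
        rw [if_neg (by rintro ⟨_, h⟩; exact hdl h)]
        have hr : y ≤ τ := by rw [← eΨlo]; exact hnondeep lo hloj hdl
        have h4 : (1 - g) * y ≤ (1 - g) * τ := mul_le_mul_of_nonneg_left hr (by linarith [hg.2])
        linarith

end LawDec

end Quant

end Summit.CriticalPhenomena.PercolationContinuityZ3.Theorems
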